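import Mathlib.RingTheory.GradedAlgebra.Basic
import Mathlib.RingTheory.MvPowerSeries.Basic
import Mathlib.Data.Finsupp.Weight
import HarnessLib

/-!
# Crux `FrobeniusLadder.FRationalResolution` (stmt-ResolutionOfSingularities-15317), line `redirect`,
# stub `stub_diagonalizableQuotientResolution` — THE WEIGHT GRADING OF A POWER SERIES RING BY A FINITE MONOID
# (the graded structure `κ'[[y₁,…,yₙ]] = ⊕_{w ∈ ℤ/r} A_w` consumed by `…GradedDivisorialFinite.finite_traceIdeals_divisorial`, p840298)

For a commutative ring `k`, variables `σ`, a FINITE additive commutative monoid `M` (e.g. `ZMod r`) and weights `w : σ → M`, the power series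
ring `k[[σ]]` is the INTERNAL DIRECT SUM of the `k`-submodules `A_i = {f : every monomial of f has weight i}`, and this is a graded algebra
structure (`GradedAlgebra`, Mathlib): ★ `exists_gradedAlgebra_weight`. (For polynomial rings Mathlib has `MvPolynomial.weightedGradedAlgebra`
for arbitrary `M`; power series only decompose when `M` is finite.) With `…GradedDivisorialFinite` this leaves, for the `hfin` slot of the (S1)
recipe at a twisted isolated point, only the identification `Ê ≅ κ'[[y]]₀` (degree-zero part for the weights `(1,a,b)` mod `r`).

Honest label: general algebra toward ONE leaf stub (no stub, crux or summit closed). No definitions (the grading is packaged existentially, as in the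
stub's own hypothesis), no named facts, no sorry. [folklore; cite: BrunsHerzog1993, §1.5]
-/

-- single-problem summit: the doubled namespace component is forced
set_option linter.dupNamespace false

open DirectSum

namespace Summit.ResolutionOfSingularities.ResolutionOfSingularities.Theorems.FRationalResolution.WeightGrading

/-- ★ **The weight grading of `k[[σ]]` by a finite monoid.** There is a graded-algebra structure on `MvPowerSeries σ k` whose degree-`i` piece
consists of the power series all of whose monomials `m` (with nonzero coefficient) have weight `Σ m(s)·w(s) = i`. [folklore] -/
theorem exists_gradedAlgebra_weight {σ : Type*} (k : Type*) [CommRing k] {M : Type*} [AddCommMonoid M] [DecidableEq M] [Fintype M]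
    (w : σ → M) :
    ∃ (𝒜 : M → Submodule k (MvPowerSeries σ k)) (_ : GradedAlgebra 𝒜),
      ∀ (i : M) (f : MvPowerSeries σ k), f ∈ 𝒜 i ↔ ∀ m : σ →₀ ℕ, MvPowerSeries.coeff m f ≠ 0 → Finsupp.weight w m = i := by
  classical
  -- the pieces
  let 𝒜 : M → Submodule k (MvPowerSeries σ k) := fun i =>
    { carrier := {f | ∀ m : σ →₀ ℕ, MvPowerSeries.coeff m f ≠ 0 → Finsupp.weight w m = i}
      zero_mem' := fun m hm => (hm (by rw [map_zero])).elim
      add_mem' := fun {f g} hf hg m hm => by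
        by_cases hfm : MvPowerSeries.coeff m f = 0
        · rw [map_add, hfm, zero_add] at hm
          exact hg m hm
        · exact hf m hfm
      smul_mem' := fun c f hf m hm => by
        rw [map_smul, smul_eq_mul] at hm
        exact hf m (right_ne_zero_of_mul hm) }
  have hmem : ∀ (i : M) (f : MvPowerSeries σ k), f ∈ 𝒜 i ↔ ∀ m : σ →₀ ℕ, MvPowerSeries.coeff m f ≠ 0 → Finsupp.weight w m = i :=
    fun _ _ => Iff.rfl
  -- the projections
  let π : M → MvPowerSeries σ k → MvPowerSeries σ k := fun i f m => if Finsupp.weight w m = i then f m else 0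
  have hπ : ∀ (i : M) (f : MvPowerSeries σ k) (m : σ →₀ ℕ),
      MvPowerSeries.coeff m (π i f) = if Finsupp.weight w m = i then MvPowerSeries.coeff m f else 0 := fun _ _ _ => rfl
  have hπmem : ∀ i f, π i f ∈ 𝒜 i := by
    intro i f m hm
    rw [hπ] at hm
    by_contra h
    exact hm (if_neg h)
  have hπzero : ∀ i, π i 0 = 0 := fun i => MvPowerSeries.ext fun m => by
    rw [hπ]
    split_ifs <;> simp
  have hπadd : ∀ i f g, π i (f + g) = π i f + π i g := fun i f g => MvPowerSeries.ext fun m => by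
    simp only [hπ, map_add]
    split_ifs <;> simp
  have hπself : ∀ (i : M) (y : MvPowerSeries σ k), y ∈ 𝒜 i → π i y = y := fun i y hy => MvPowerSeries.ext fun m => by
    rw [hπ]
    split_ifs with h
    · rfl
    · by_contra hc
      exact h (hy m (Ne.symm hc))
  have hπne : ∀ (i j : M) (y : MvPowerSeries σ k), y ∈ 𝒜 i → j ≠ i → π j y = 0 := fun i j y hy hji => MvPowerSeries.ext fun m => by
    rw [hπ, map_zero]
    split_ifs with h
    · by_contra hc
      exact hji (h.symm.trans (hy m hc))
    · rfl
  -- graded monoid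
  letI gm : SetLike.GradedMonoid 𝒜 :=
    { one_mem := fun m hm => by
        rw [MvPowerSeries.coeff_one] at hm
        split_ifs at hm with h
        · rw [h, map_zero]
        · exact (hm rfl).elim
      mul_mem := fun {i j f g} hf hg m hm => by
        rw [MvPowerSeries.coeff_mul] at hm
        obtain ⟨p, hp, hne⟩ := Finset.exists_ne_zero_of_sum_ne_zero hm
        rw [Finset.mem_antidiagonal] at hp
        rw [← hp, map_add, hf _ (left_ne_zero_of_mul hne), hg _ (right_ne_zero_of_mul hne)] }
  -- the decomposition
  let δ : MvPowerSeries σ k →+ ⨁ i, 𝒜 i :=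
    { toFun := fun f => ∑ i : M, DirectSum.of (fun i => ↥(𝒜 i)) i ⟨π i f, hπmem i f⟩
      map_zero' := Finset.sum_eq_zero fun i _ => by
        have h0 : (⟨π i 0, hπmem i 0⟩ : 𝒜 i) = 0 := Subtype.ext (hπzero i)
        rw [h0, map_zero]
      map_add' := fun f g => by
        rw [← Finset.sum_add_distrib]
        refine Finset.sum_congr rfl fun i _ => ?_
        rw [← map_add]
        exact congrArg _ (Subtype.ext (hπadd i f g)) }
  have hδ : ∀ f, δ f = ∑ i : M, DirectSum.of (fun i => ↥(𝒜 i)) i ⟨π i f, hπmem i f⟩ := fun _ => rfl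
  have hleft : (DirectSum.coeAddMonoidHom 𝒜).comp δ = AddMonoidHom.id _ := by
    refine AddMonoidHom.ext fun f => ?_
    rw [AddMonoidHom.comp_apply, AddMonoidHom.id_apply, hδ, map_sum]
    simp only [DirectSum.coeAddMonoidHom_of]
    refine MvPowerSeries.ext fun m => ?_
    rw [map_sum]
    simp only [hπ]
    rw [Finset.sum_ite_eq]
    simp
  have hright : δ.comp (DirectSum.coeAddMonoidHom 𝒜) = AddMonoidHom.id _ := by
    refine DirectSum.addHom_ext fun i y => ?_
    rw [AddMonoidHom.comp_apply, DirectSum.coeAddMonoidHom_of, AddMonoidHom.id_apply, hδ]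
    rw [Finset.sum_eq_single i]
    · congr 1
      exact Subtype.ext (hπself i y y.2)
    · intro j _ hji
      have h0 : (⟨π j y, hπmem j y⟩ : 𝒜 j) = 0 := Subtype.ext (hπne i j y y.2 hji)
      rw [h0, map_zero]
    · intro h
      exact (h (Finset.mem_univ i)).elim
  letI dec : DirectSum.Decomposition 𝒜 := DirectSum.Decomposition.ofAddHom 𝒜 δ hleft hright
  exact ⟨𝒜, { toGradedMonoid := gm, toDecomposition := dec }, hmem⟩

end Summit.ResolutionOfSingularities.ResolutionOfSingularities.Theorems.FRationalResolution.WeightGrading
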